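import Literature.MathematicalPhysics.QuantumFieldTheory.Balaban1983to89.B5Hk163TorusHolder

/-!
# `Balaban1983to89.B5Hk163TorusHolderDecay` — the DECAYING Hölder bound for the typed torus `∂_νH_k`
(cell GAPS G-b05g11-1, main part; successor of `B5Hk163TorusHolder`, `B5Hk163Torus`, `B5Hk163Decay`)

T. Bałaban, *Propagators and renormalization transformations for lattice gauge theories. I*, Commun. Math. Phys.
**95**, 17–40 (1984) [`Balaban1984PropagatorsI`, cell paper B5].  PRINTED TEXT (locations only; renders
`1984-cmp95-propagators-rt-I-p012/p013` = journal pp.28/29, verified by this seat): p.28 last two lines – p.29 lines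
1–2, right after (1.63): «Another important property is that the sum over l of the absolute value of this
expression multiplied by |∂_ν(p′+l)||p′+l|^α is bounded by a constant dependent on d only. This implies bounds on
(1/|x′−x|^α)|∂_ν(H_kB)_μ(x′) − ∂_ν(H_kB)_μ(x)| (see the proof of Lemma 2.4 in [2].)»
Everything typed below (the torus model `T_η → T₁` with unitary gauge `U = 1`, `m² = 0`, the derivative multiplier,
the interpolation and all constants) is OUR reading, outside «».

WHAT THIS MODULE ADDS to `B5Hk163TorusHolder` (which proved the NON-decaying kernel Hölder bound
`|∂_νH_k(x′+z̄, y) − ∂_νH_k(x′, y)| ≤ CHolderTorus(d,α)·(‖z‖₂/n)^α`, uniformly in `n`): the DECAY IN `y`.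

* §1 `D163 n μ λ ν a` — the DERIVATIVE MULTIPLIER `D_{ν,a}(p′) = Σ_l e^{i(p′+l)·ηa}·∂_ν(p′+l)·h_{l;μλ}(p′)` of the
  kernel of `∂_νH_k` from a coarse point to the fine point `n·ȳ′ + a` (pattern `B5Hk163Decay.G163`, one extra factor
  `∂_ν(p′+l) = B5Hk163Strip.dC`): side periodicity `D163_tr` (`dC_tr`, `phase163_tr`, `h163_tr`), the STRIP BOUND
  `‖D_{ν,a}(p′)‖ ≤ (e^κ)^d · CHolder163 d 0` (`norm_D163_le`: the landed strip weighted alias sum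
  `B5Hk163Holder.weighted_alias_sum_le` at Hölder exponent `0`, times `B5Hk163Decay.norm_phase163_le`), holomorphy,
  `StripRegular` in dimension `d+1` (`stripRegular_D163`) and the torus-kernel decay `torusKernel_D163_decay`
  (`B4TorusKernel.MultiPeriod.torusKernel_descend_decay_torusMetric` BY NAME).
* §2 the dictionary `dker_bpt : ∂_νH_k(n·ȳ′ + a, y) = dgker a (y′ − y)` (pattern `B5Hk163Torus.hker_bpt`) and
  `dgker_toT_eq_torusKernel`; hence the n-UNIFORM EXPONENTIAL DECAY of the kernel of `∂_νH_k`
  (`norm_dker_bpt_le`): `|∂_νH_k((n·x̄′+a, μ), (x̄, λ))| ≤ MD163(d+1)·periodConst·e^{−(κ₁₆₃(d+1)/(d+1))|x′−x|_{T,∞}}`.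
* §3 GEOMETRIC INTERPOLATION (`interp_le`: `X ≤ A`, `X ≤ B` ⇒ `X ≤ A^θ B^{1−θ}`) between the landed Hölder bound at
  the LARGER exponent `α′ = (1+α)/2 < 1` and the decaying sup bound of §2, with `θ = 2α/(1+α)` (so `α′θ = α`):
  THE DECAYING HÖLDER BOUND `norm_dker_sub_le_decay` — for fine points `x₁ = n·ȳ₁ + a₁`, `x₂ = n·ȳ₂ + a₂ = x₁ + z̄`,
  `|∂_νH_k(x₂, x̄) − ∂_νH_k(x₁, x̄)| ≤ CHD(d,α)·(‖z‖₂/n)^α·max(e^{−δ|y₂−x|_T}, e^{−δ|y₁−x|_T})^{(1−α)/(1+α)}`,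
  `δ = κ₁₆₃(d+1)/(d+1)`, i.e. decay at rate `δ(1−α)/(1+α)` from the NEARER endpoint block (`norm_dker_sub_le_decay'`),
  and the operator form `norm_fdiff_HkOp_mulVec_sub_le_decay` (exponentially weighted `ℓ¹` sum of `|B|`).

HONEST LIMITS. (i) The decay rate degrades to `0` as `α ↑ 1` (interpolation artefact; the paper's contour-shift of
the full Hölder multiplier would give rate independent of `α` — not done here). (ii) Torus model, `U = 1`, `m² = 0`
as in the whole typed (1.63) chain; constants dimension-only and ours. (iii) The typed statement `R∂*H_kB = 0` /
minimum property of the typed `H_k` (cell menu (b)) is NOT addressed. No Mathlib gap.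
VALUE: a kernel certificate of one printed consequence of (1.63) in the cell's torus model — NOT summit progress.
-/

open scoped BigOperators Matrix ComplexConjugate Real
open Finset Complex

namespace Literature.MathematicalPhysics.QuantumFieldTheory.Balaban1983to89.B5Hk163TorusHolderDecay

open Literature.MathematicalPhysics.QuantumFieldTheory.Balaban1983to89.B4Strip (ofRealVec Strip)
open Literature.MathematicalPhysics.QuantumFieldTheory.Balaban1983to89.B4ContourShift (BZ StripRegular
  insertNth_mem_Strip openRect_subset_closedRect)
open Literature.MathematicalPhysics.QuantumFieldTheory.Balaban1983to89.B4TorusKernel (descendC descendC_apply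
  face_match rep_mem periodConst)
open Literature.MathematicalPhysics.QuantumFieldTheory.Balaban1983to89.B4TorusKernel.MultiPeriod (torusSum
  torusKernel torusSupNorm torusKernel_descend_decay_torusMetric)
open Literature.MathematicalPhysics.QuantumFieldTheory.Balaban1983to89.B5Prop11Plancherel (Tor chi fine sOf fdiff
  conj_chi chi_add_right abs_sOf_le)
open Literature.MathematicalPhysics.QuantumFieldTheory.Balaban1983to89.B5Prop11Fiber (dSym)
open Literature.MathematicalPhysics.QuantumFieldTheory.Balaban1983to89.B5Block118 (up iota bpt pOf chi_pOf_up)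
open Literature.MathematicalPhysics.QuantumFieldTheory.Balaban1983to89.B5Strip145Analytic (sigma sigmaEquiv tr)
open Literature.MathematicalPhysics.QuantumFieldTheory.Balaban1983to89.B5Strip145Decay (differentiableAt_insertNth
  tr_insertNth_left insertNth_left_mem)
open Literature.MathematicalPhysics.QuantumFieldTheory.Balaban1983to89.B5Hk163Strip (dC dC_ofReal h163 kappa163
  kappa163_pos differentiable_dC differentiableAt_h163)
open Literature.MathematicalPhysics.QuantumFieldTheory.Balaban1983to89.B5Hk163Alias (dC_tr h163_tr)
open Literature.MathematicalPhysics.QuantumFieldTheory.Balaban1983to89.B5Hk163Holder (wt163 CHolder163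
  weighted_alias_sum_le)
open Literature.MathematicalPhysics.QuantumFieldTheory.Balaban1983to89.B5Hk163Decay (phase163 norm_phase163_le
  differentiable_phase163 phase163_tr)
open Literature.MathematicalPhysics.QuantumFieldTheory.Balaban1983to89.B5Kernel166Decay (torFin card_Tor_cast
  toT_sub chi_toT_eq_mFourier two_pi_rep_grid chi_neg_comm)
open Literature.MathematicalPhysics.QuantumFieldTheory.Balaban1983to89.B5Hk163Torus (HkOp phase163_sOf)
open Literature.MathematicalPhysics.QuantumFieldTheory.Balaban1983to89.B5Hk163TorusHolder (zlen zlen_nonneg dker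
  dker_eq fdiff_HkOp_mulVec CHolderTorus norm_dker_transl_sub_le)
open Literature.MathematicalPhysics.QuantumFieldTheory.Balaban1983to89.B6LowerBound2153Torus (toT)
open Literature.MathematicalPhysics.QuantumFieldTheory.Balaban1983to89.B6Cov2156Torus (one_le_M)

noncomputable section

variable {d : ℕ}

/-! ## §1. The derivative multiplier `D_{ν,a}`: side periodicity, strip bound, holomorphy, strip regularity -/

section Multiplier

variable (n : ℕ) [NeZero n]

/-- the DERIVATIVE MULTIPLIER of the kernel of `∂_νH_k` from a coarse point to the fine point `n·ȳ′ + a`: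
`D_{ν,a}(p′) = Σ_l e^{i(p′+l)·ηa} · ∂_ν(p′+l) · h_{l;μλ}(p′)` (`phase163 · dC · h163`, summed over the alias index
`l = 2πk`). [cite: Balaban1984PropagatorsI, p.28 last two lines «the sum over l of the absolute value of this expression multiplied by |∂_ν(p′+l)|…» (the `l`-sum at exponent 0; the fine-offset phase and torus reading ours)] [folklore] -/
def D163 (μ lam ν : Fin d) (a : Fin d → Fin n) (p : Fin d → ℂ) : ℂ :=
  ∑ k : Fin d → Fin n, phase163 n k a p * dC n k p ν * h163 n μ lam k p

/-- **SIDE PERIODICITY**: at a side point `Re p′_{ν₁} = −π` of the strip, `D_{ν,a}(p′ + 2πe_{ν₁}) = D_{ν,a}(p′)` —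
all three factors are `σ_{ν₁}`-covariant (`phase163_tr`, `dC_tr`, `h163_tr`) and `σ_{ν₁}` permutes the alias family.
[folklore] -/
theorem D163_tr {κ : ℝ} (hκ0 : 0 ≤ κ) (hκ : κ ≤ kappa163 d) {p : Fin d → ℂ} (hp : p ∈ Strip d κ) (ν₁ : Fin d)
    (hre : (p ν₁).re = -Real.pi) (μ lam ν : Fin d) (a : Fin d → Fin n) :
    D163 n μ lam ν a (tr p ν₁) = D163 n μ lam ν a p := by
  unfold D163
  have h : ∀ k : Fin d → Fin n, phase163 n k a (tr p ν₁) * dC n k (tr p ν₁) ν * h163 n μ lam k (tr p ν₁) =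
      phase163 n (sigma n ν₁ k) a p * dC n (sigma n ν₁ k) p ν * h163 n μ lam (sigma n ν₁ k) p := fun k => by
    rw [phase163_tr, dC_tr, h163_tr n hκ0 hκ hp ν₁ hre μ lam k]
  simp_rw [h]
  exact Equiv.sum_comp (sigmaEquiv n ν₁) (fun k => phase163 n k a p * dC n k p ν * h163 n μ lam k p)

omit [NeZero n] in
/-- at Hölder exponent `0` the weight `wt163` is `‖∂_ν(p′+l)‖`. [folklore] -/
theorem wt163_zero (k : Fin d → Fin n) (p : Fin d → ℂ) (ν : Fin d) : wt163 n k p ν 0 = ‖dC n k p ν‖ := by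
  unfold wt163
  rw [zero_div, Real.rpow_zero, mul_one]

/-- **THE STRIP BOUND** `‖D_{ν,a}(p′)‖ ≤ (e^κ)^d · CHolder163 d 0` on the closed strip `|Im p′_μ| ≤ κ ≤ κ₁₆₃(d)`,
uniformly in `n` and in the fine offset `a`: `|e^{i(p′+l)·ηa}| ≤ (e^κ)^d` (`B5Hk163Decay.norm_phase163_le`) and
`Σ_l ‖h_l‖·‖∂_ν(p′+l)‖ ≤ CHolder163 d 0` (`B5Hk163Holder.weighted_alias_sum_le` at exponent `0`).
[cite: Balaban1984PropagatorsI, p.28 last two lines – p.29 line 1 «… is bounded by a constant dependent on d only.» (exponent-0 case, extended by us to the complex strip)] [folklore] -/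
theorem norm_D163_le {κ : ℝ} (hκ0 : 0 ≤ κ) (hκ : κ ≤ kappa163 d) {p : Fin d → ℂ} (hp : p ∈ Strip d κ)
    (μ lam ν : Fin d) (a : Fin d → Fin n) : ‖D163 n μ lam ν a p‖ ≤ Real.exp κ ^ d * CHolder163 d 0 := by
  have hw : ∑ k : Fin d → Fin n, ‖h163 n μ lam k p‖ * ‖dC n k p ν‖ ≤ CHolder163 d 0 := by
    have h := weighted_alias_sum_le n hκ0 hκ hp μ lam ν le_rfl zero_lt_one
    simpa only [wt163_zero] using h
  unfold D163
  calc ‖∑ k : Fin d → Fin n, phase163 n k a p * dC n k p ν * h163 n μ lam k p‖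
      ≤ ∑ k : Fin d → Fin n, ‖phase163 n k a p * dC n k p ν * h163 n μ lam k p‖ := norm_sum_le _ _
    _ ≤ ∑ k : Fin d → Fin n, Real.exp κ ^ d * (‖h163 n μ lam k p‖ * ‖dC n k p ν‖) := by
        refine Finset.sum_le_sum (fun k _ => ?_)
        rw [norm_mul, norm_mul]
        have h1 := norm_phase163_le n hp k a
        have h2 := norm_nonneg (dC n k p ν)
        have h3 := norm_nonneg (h163 n μ lam k p)
        calc ‖phase163 n k a p‖ * ‖dC n k p ν‖ * ‖h163 n μ lam k p‖
            ≤ Real.exp κ ^ d * ‖dC n k p ν‖ * ‖h163 n μ lam k p‖ := by gcongr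
          _ = Real.exp κ ^ d * (‖h163 n μ lam k p‖ * ‖dC n k p ν‖) := by ring
    _ = Real.exp κ ^ d * ∑ k : Fin d → Fin n, ‖h163 n μ lam k p‖ * ‖dC n k p ν‖ := by rw [Finset.mul_sum]
    _ ≤ Real.exp κ ^ d * CHolder163 d 0 := mul_le_mul_of_nonneg_left hw (by positivity)

/-- **HOLOMORPHY**: `D_{ν,a}` is (jointly) holomorphic at every point of the zero-free strip. [folklore] -/
theorem differentiableAt_D163 {κ : ℝ} (hκ0 : 0 ≤ κ) (hκ : κ ≤ kappa163 d) {p : Fin d → ℂ}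
    (hp : p ∈ Strip d κ) (μ lam ν : Fin d) (a : Fin d → Fin n) :
    DifferentiableAt ℂ (fun q : Fin d → ℂ => D163 n μ lam ν a q) p := by
  unfold D163
  exact DifferentiableAt.fun_sum (fun k _ =>
    (((differentiable_phase163 n k a) p).mul ((differentiable_dC n k ν) p)).mul
      (differentiableAt_h163 n hκ0 hκ hp μ lam k))

end Multiplier

section Regular

/-- the explicit `d`-only strip/decay constant of the derivative multipliers, `(e^{κ₁₆₃(d)})^d · CHolder163 d 0`.
[folklore] -/
def MD163 (d : ℕ) : ℝ := Real.exp (kappa163 d) ^ d * CHolder163 d 0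

/-- **STRIP REGULARITY OF THE DERIVATIVE MULTIPLIERS** on `ℂ^{d+1}` at `κ = κ₁₆₃(d+1)`: for EVERY `n ≥ 1`, `μ`, `λ`,
`ν`, fine offset `a`, `D163 n μ λ ν a` is continuous on the closed strip, holomorphic in every coordinate slice, takes
equal values on the vertical sides, and is bounded by `MD163 (d+1)` (pattern `B5Hk163Decay.stripRegular_G163`).
[folklore] -/
theorem stripRegular_D163 (n : ℕ) [NeZero n] (μ lam ν : Fin (d + 1)) (a : Fin (d + 1) → Fin n) :
    StripRegular (d := d) (fun p : Fin (d + 1) → ℂ => D163 n μ lam ν a p) (kappa163 (d + 1)) (MD163 (d + 1)) := by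
  have hκ0 : 0 ≤ kappa163 (d + 1) := (kappa163_pos _).le
  have hdiffAt : ∀ p ∈ Strip (d + 1) (kappa163 (d + 1)),
      DifferentiableAt ℂ (fun q : Fin (d + 1) → ℂ => D163 n μ lam ν a q) p :=
    fun p hp => differentiableAt_D163 n hκ0 le_rfl hp μ lam ν a
  refine ⟨?_, ?_, ?_, ?_⟩
  · exact fun p hp => (hdiffAt p hp).continuousAt.continuousWithinAt
  · intro i q hq z hz
    have hP : i.insertNth z (ofRealVec q) ∈ Strip (d + 1) (kappa163 (d + 1)) :=
      insertNth_mem_Strip hκ0 i hq (openRect_subset_closedRect _ hz)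
    exact ((hdiffAt _ hP).comp z (differentiableAt_insertNth i _ z)).differentiableWithinAt
  · intro i q hq y hy
    obtain ⟨hP, hre⟩ := insertNth_left_mem hκ0 i hq hy
    show D163 n μ lam ν a _ = D163 n μ lam ν a _
    rw [← tr_insertNth_left]
    exact (D163_tr n hκ0 le_rfl hP i hre μ lam ν a).symm
  · intro p hp
    exact norm_D163_le n hκ0 le_rfl hp μ lam ν a

/-- **EXPONENTIAL DECAY OF THE TORUS KERNELS** of `D_{ν,a}`
(`B4TorusKernel.MultiPeriod.torusKernel_descend_decay_torusMetric` BY NAME): for every period vector `N` (all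
`N_i ≥ 1`), `n ≥ 1`, `μ`, `λ`, `ν`, `a`, `x`:
`‖K_{ν,a,N}(x)‖ ≤ MD163(d+1) · periodConst(κ₁₆₃(d+1), d) · e^{−(κ₁₆₃(d+1)/(d+1))·|x|_{T,∞}}`. [folklore] -/
theorem torusKernel_D163_decay (n : ℕ) [NeZero n] (μ lam ν : Fin (d + 1)) (a : Fin (d + 1) → Fin n)
    {N : Fin (d + 1) → ℕ} (hN : ∀ i, 1 ≤ N i) (x : Fin (d + 1) → ℤ) :
    ‖torusKernel (descendC (fun p : Fin (d + 1) → ℂ => D163 n μ lam ν a p)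
        (stripRegular_D163 n μ lam ν a) (kappa163_pos _).le) N x‖ ≤
      MD163 (d + 1) * periodConst (kappa163 (d + 1)) d *
        Real.exp (-(kappa163 (d + 1) / (d + 1) * torusSupNorm N x)) :=
  torusKernel_descend_decay_torusMetric _ (kappa163_pos _) hN x

end Regular

/-! ## §2. The dictionary for `∂_νH_k` and the n-uniform exponential decay of its kernel -/

section Dictionary

variable (n : ℕ) [NeZero n] (M : Fin d → ℕ) [hM : ∀ μ, NeZero (M μ)]

/-- the kernel of `∂_νH_k` between a block point and a coarse point as the torus momentum sum of `D_{ν,a}`: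
`dgker a w = |T₁|⁻¹ Σ_{p′} e^{ip′·w} D_{ν,a}(p′)`. [folklore] -/
def dgker (μ lam ν : Fin d) (a : Fin d → Fin n) (w : Tor M) : ℂ :=
  ((Fintype.card (Tor M) : ℂ))⁻¹ * ∑ q : Tor M, chi M q w * D163 n μ lam ν a (ofRealVec (sOf M q))

/-- **THE DICTIONARY FOR `∂_νH_k`**: the kernel of `∂_νH_k` from the coarse point `y` to the fine point `n·y′ + a`
(`bpt y′ a`) is `dgker a (y′ − y)` — from the momentum form `B5Hk163TorusHolder.dker_eq`
(`e^{i(p′+l)·(ny′+a)} = e^{ip′·y′}·e^{i(p′+l)·ηa}`: `B5Block118.chi_pOf_up`, `B5Hk163Torus.phase163_sOf`; the symbol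
`∂^η_ν(p′+l)` is `dC` at the real momentum: `B5Hk163Strip.dC_ofReal`; pattern `B5Hk163Torus.hker_bpt`). [folklore] -/
theorem dker_bpt (μ lam ν : Fin d) (y' : Tor M) (a : Fin d → Fin n) (y : Tor M) :
    dker n M μ lam ν (bpt n M y' a) y = dgker n M μ lam ν a (y' - y) := by
  rw [dker_eq]
  unfold dgker D163
  congr 1
  rw [Fintype.sum_prod_type, Finset.sum_comm]
  refine Finset.sum_congr rfl fun q _ => ?_
  rw [Finset.mul_sum]
  refine Finset.sum_congr rfl fun k _ => ?_
  dsimp only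
  rw [bpt, chi_add_right, chi_pOf_up, ← phase163_sOf, conj_chi, chi_neg_comm, sub_eq_add_neg, chi_add_right,
    dC_ofReal]
  ring

end Dictionary

section Kernel

variable (n : ℕ) [NeZero n] (M : Fin (d + 1) → ℕ) [hM : ∀ μ, NeZero (M μ)]

/-- the two momentum conventions on the grid (`2π rep(t/M) ∈ [−π,π)` of the engine versus `sOf ∈ (−π,π]`) give the
same value of `D_{ν,a}` (face flip absorbed by the side periodicity: `B4TorusKernel.face_match` +
`stripRegular_D163`; pattern `B5Hk163Torus.G163_grid_eq`). [folklore] -/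
theorem D163_grid_eq (μ lam ν : Fin (d + 1)) (a : Fin (d + 1) → Fin n) (t : Tor M) :
    D163 n μ lam ν a
        (ofRealVec (fun i => 2 * Real.pi * B4TorusKernel.rep ((((torFin M t i : ℕ) : ℝ) / M i : ℝ) : UnitAddCircle)))
      = D163 n μ lam ν a (ofRealVec (sOf M t)) := by
  classical
  set u : Fin (d + 1) → ℝ :=
    fun i => 2 * Real.pi * B4TorusKernel.rep ((((torFin M t i : ℕ) : ℝ) / M i : ℝ) : UnitAddCircle) with hu_def
  have hdich : ∀ i, u i = sOf M t i ∨ (u i = -Real.pi ∧ sOf M t i = Real.pi) := fun i => two_pi_rep_grid M t i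
  have hu : u ∈ BZ (d + 1) := by
    refine ⟨fun i => ?_, fun i => ?_⟩
    · have h := (rep_mem (((((torFin M t i : ℕ) : ℝ) / M i : ℝ) : UnitAddCircle))).1
      show -Real.pi ≤ 2 * Real.pi * _
      nlinarith [Real.pi_pos]
    · have h := (rep_mem (((((torFin M t i : ℕ) : ℝ) / M i : ℝ) : UnitAddCircle))).2
      show 2 * Real.pi * _ ≤ Real.pi
      nlinarith [Real.pi_pos]
  have hv : sOf M t ∈ BZ (d + 1) :=
    ⟨fun i => (abs_le.mp (abs_sOf_le M t i)).1, fun i => (abs_le.mp (abs_sOf_le M t i)).2⟩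
  refine face_match (stripRegular_D163 n μ lam ν a) (kappa163_pos _).le
    (Finset.univ.filter fun i => u i ≠ sOf M t i) u (sOf M t) hu hv (fun i hi => ?_) (fun i hi => ?_)
  · by_contra h
    exact hi (Finset.mem_filter.mpr ⟨Finset.mem_univ _, h⟩)
  · have h := (Finset.mem_filter.mp hi).2
    rcases hdich i with h' | h'
    · exact absurd h' h
    · exact h'

/-- **THE KERNEL OF `∂_νH_k` IS THE TORUS KERNEL OF `D_{ν,a}`**: at a lattice representative `x`,
`dgker a (x̄) = B4TorusKernel.MultiPeriod.torusKernel (descendC D_{ν,a}) M x` (pattern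
`B5Hk163Torus.gker_toT_eq_torusKernel`). [folklore] -/
theorem dgker_toT_eq_torusKernel (μ lam ν : Fin (d + 1)) (a : Fin (d + 1) → Fin n) (x : Fin (d + 1) → ℤ) :
    dgker n M μ lam ν a (toT M x)
      = torusKernel (descendC (fun p : Fin (d + 1) → ℂ => D163 n μ lam ν a p)
          (stripRegular_D163 n μ lam ν a) (kappa163_pos _).le) M x := by
  unfold dgker torusKernel torusSum
  rw [card_Tor_cast]
  congr 1
  refine Fintype.sum_equiv (torFin M) _ _ fun t => ?_
  rw [descendC_apply, B4TorusKernel.MultiPeriod.descend_gridPt, chi_toT_eq_mFourier, mul_comm]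
  congr 1
  exact (D163_grid_eq n M μ lam ν a t).symm

/-- **n-UNIFORM EXPONENTIAL DECAY OF THE KERNEL OF THE TYPED `∂_νH_k`**, uniformly in the period vector `M` (all
`M_i ≥ 1`), in `n ≥ 1`, `μ`, `λ`, `ν` and the fine offset `a`: for lattice representatives `x′, x ∈ ℤ^{d+1}`,
`|∂_νH_k((n·x̄′ + a, μ), (x̄, λ))| ≤ MD163(d+1) · periodConst(κ₁₆₃(d+1), d) · e^{−(κ₁₆₃(d+1)/(d+1)) |x′ − x|_{T,∞}}`
(`torusKernel_D163_decay` BY NAME; constants dimension-only, ours).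
[cite: Balaban1984PropagatorsI, p.29 lines 1–2 «(see the proof of Lemma 2.4 in [2].)» (location of the METHOD — analytic continuation in p′ and contour shift)] [folklore] -/
theorem norm_dker_bpt_le (μ lam ν : Fin (d + 1)) (a : Fin (d + 1) → Fin n) (x' x : Fin (d + 1) → ℤ) :
    ‖dker n M μ lam ν (bpt n M (toT M x') a) (toT M x)‖
      ≤ MD163 (d + 1) * periodConst (kappa163 (d + 1)) d *
          Real.exp (-(kappa163 (d + 1) / (d + 1) * torusSupNorm M (x' - x))) := by
  rw [dker_bpt, toT_sub, dgker_toT_eq_torusKernel]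
  exact torusKernel_D163_decay n μ lam ν a (one_le_M M) (x' - x)

end Kernel

/-! ## §3. Interpolation: the decaying Hölder bound -/

section Interpolation

/-- **GEOMETRIC INTERPOLATION** of two upper bounds: `0 ≤ X ≤ A`, `X ≤ B`, `0 ≤ θ ≤ 1` ⇒ `X ≤ A^θ · B^{1−θ}`.
[folklore] -/
theorem interp_le {X A B θ : ℝ} (hX : 0 ≤ X) (hA : X ≤ A) (hB : X ≤ B) (hθ0 : 0 ≤ θ) (hθ1 : θ ≤ 1) :
    X ≤ A ^ θ * B ^ (1 - θ) := by
  have hsplit : X = X ^ θ * X ^ (1 - θ) := by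
    rw [← Real.rpow_add' hX (by norm_num : θ + (1 - θ) ≠ 0), show θ + (1 - θ) = 1 by ring, Real.rpow_one]
  rw [hsplit]
  exact mul_le_mul (Real.rpow_le_rpow hX hA hθ0) (Real.rpow_le_rpow hX hB (by linarith))
    (Real.rpow_nonneg hX _) (Real.rpow_nonneg (hX.trans hA) _)

/-- the interpolation parameter `θ(α) = 2α/(1+α)` (so that `((1+α)/2)·θ = α` and `1 − θ = (1−α)/(1+α)`). [folklore] -/
def thetaH (α : ℝ) : ℝ := 2 * α / (1 + α)

/-- `0 ≤ θ(α)` for `0 ≤ α`. [folklore] -/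
theorem thetaH_nonneg {α : ℝ} (hα0 : 0 ≤ α) : 0 ≤ thetaH α := by
  unfold thetaH; positivity

/-- `θ(α) ≤ 1` for `0 ≤ α ≤ 1`. [folklore] -/
theorem thetaH_le_one {α : ℝ} (hα0 : 0 ≤ α) (hα1 : α ≤ 1) : thetaH α ≤ 1 := by
  unfold thetaH
  rw [div_le_one (by linarith)]
  linarith

/-- `1 − θ(α) = (1−α)/(1+α)`. [folklore] -/
theorem one_sub_thetaH {α : ℝ} (hα0 : 0 ≤ α) : 1 - thetaH α = (1 - α) / (1 + α) := by
  unfold thetaH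
  have h : (1 + α) ≠ 0 := by linarith
  field_simp
  ring

/-- `((1+α)/2)·θ(α) = α`. [folklore] -/
theorem half_one_add_mul_thetaH {α : ℝ} (hα0 : 0 ≤ α) : (1 + α) / 2 * thetaH α = α := by
  unfold thetaH
  have h : (1 + α) ≠ 0 := by linarith
  field_simp

/-- `0 ≤ CHolder163 d α` (`d ≥ 1`, `0 ≤ α < 1`): it dominates a sum of non-negative terms
(`B5Hk163Holder.weighted_alias_sum_le_real` at `n = 1`, `p′ = 0`). [folklore] -/
theorem CHolder163_nonneg (μ : Fin d) {α : ℝ} (hα0 : 0 ≤ α) (hα1 : α < 1) : 0 ≤ CHolder163 d α := by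
  have h0 : (0 : Fin d → ℝ) ∈ BZ d := ⟨fun _ => neg_nonpos.mpr Real.pi_pos.le, fun _ => Real.pi_pos.le⟩
  refine le_trans (Finset.sum_nonneg fun k _ => mul_nonneg (norm_nonneg _) ?_)
    (B5Hk163Holder.weighted_alias_sum_le_real 1 h0 μ μ μ hα0 hα1)
  unfold wt163
  exact mul_nonneg (norm_nonneg _) (Real.rpow_nonneg (Finset.sum_nonneg fun _ _ => sq_nonneg _) _)

/-- `0 ≤ CHolderTorus d α` (`d ≥ 1`, `0 ≤ α < 1`). [folklore] -/
theorem CHolderTorus_nonneg (μ : Fin d) {α : ℝ} (hα0 : 0 ≤ α) (hα1 : α < 1) : 0 ≤ CHolderTorus d α := by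
  unfold CHolderTorus
  have h := CHolder163_nonneg μ hα0 hα1
  have hπ := Real.pi_pos
  positivity

/-- the decay constant of the kernel of `∂_νH_k` in dimension `d + 1`, `MD163(d+1)·periodConst(κ₁₆₃(d+1), d)`.
[folklore] -/
def CdecD (d : ℕ) : ℝ := MD163 (d + 1) * periodConst (kappa163 (d + 1)) d

/-- the constant of the decaying Hölder bound in dimension `d + 1`:
`CHD(d,α) = CHolderTorus(d+1, (1+α)/2)^{θ(α)} · (2·CdecD d)^{1−θ(α)}`. [folklore] -/
def CHD (d : ℕ) (α : ℝ) : ℝ := CHolderTorus (d + 1) ((1 + α) / 2) ^ thetaH α * (2 * CdecD d) ^ (1 - thetaH α)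

variable (n : ℕ) [NeZero n] (M : Fin (d + 1) → ℕ) [hM : ∀ μ, NeZero (M μ)]

/-- `0 ≤ CdecD d`: the kernel bound `norm_dker_bpt_le` has a strictly positive exponential factor. [folklore] -/
theorem CdecD_nonneg : 0 ≤ CdecD d := by
  have h := (norm_nonneg _).trans
    (norm_dker_bpt_le 1 (fun _ : Fin (d + 1) => 1) 0 0 0 (fun _ => 0) 0 0)
  have hE := Real.exp_pos (-(kappa163 (d + 1) / (d + 1) * torusSupNorm (fun _ : Fin (d + 1) => 1) (0 - 0)))
  by_contra hneg
  have hneg : CdecD d < 0 := lt_of_not_ge hneg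
  have : MD163 (d + 1) * periodConst (kappa163 (d + 1)) d *
      Real.exp (-(kappa163 (d + 1) / (d + 1) * torusSupNorm (fun _ : Fin (d + 1) => 1) (0 - 0))) < 0 :=
    mul_neg_of_neg_of_pos hneg hE
  linarith

/-- **THE DECAYING HÖLDER BOUND FOR THE KERNEL OF THE TYPED `∂_νH_k`** (torus model, dimension `d + 1 ≥ 1`,
uniformly in `n ≥ 1` and in the period vector): for fine points `x₁ = n·ȳ₁ + a₁` and `x₂ = n·ȳ₂ + a₂ = x₁ + z̄`
(`z ∈ ℤ^{d+1}` any representative of the displacement), every coarse point `x̄` and `0 ≤ α < 1`,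
`|∂_νH_k((x₂, μ), (x̄, λ)) − ∂_νH_k((x₁, μ), (x̄, λ))|
   ≤ CHD(d,α) · (‖z‖₂/n)^α · max(e^{−δ|y₂−x|_{T,∞}}, e^{−δ|y₁−x|_{T,∞}})^{1−θ(α)}`, `δ = κ₁₆₃(d+1)/(d+1)`,
`1 − θ(α) = (1−α)/(1+α)` — interpolation (`interp_le`) between `B5Hk163TorusHolder.norm_dker_transl_sub_le` at
exponent `(1+α)/2` and the decaying sup bound `norm_dker_bpt_le` at both endpoints.
[cite: Balaban1984PropagatorsI, p.29 lines 1–2 «This implies bounds on (1/|x′−x|^α)|∂_ν(H_kB)_μ(x′) − ∂_ν(H_kB)_μ(x)| (see the proof of Lemma 2.4 in [2].)» (typed torus reading, interpolation route and constants ours)] [folklore] -/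
theorem norm_dker_sub_le_decay (μ lam ν : Fin (d + 1)) (y₁ y₂ x : Fin (d + 1) → ℤ)
    (a₁ a₂ : Fin (d + 1) → Fin n) (z : Fin (d + 1) → ℤ)
    (hz : bpt n M (toT M y₂) a₂ = bpt n M (toT M y₁) a₁ + toT (fine n M) z) {α : ℝ} (hα0 : 0 ≤ α) (hα1 : α < 1) :
    ‖dker n M μ lam ν (bpt n M (toT M y₂) a₂) (toT M x) - dker n M μ lam ν (bpt n M (toT M y₁) a₁) (toT M x)‖
      ≤ CHD d α * (zlen z / n) ^ α *
          max (Real.exp (-(kappa163 (d + 1) / (d + 1) * torusSupNorm M (y₂ - x))))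
              (Real.exp (-(kappa163 (d + 1) / (d + 1) * torusSupNorm M (y₁ - x)))) ^ (1 - thetaH α) := by
  set X := ‖dker n M μ lam ν (bpt n M (toT M y₂) a₂) (toT M x) - dker n M μ lam ν (bpt n M (toT M y₁) a₁) (toT M x)‖
    with hX_def
  set E₂ := Real.exp (-(kappa163 (d + 1) / (d + 1) * torusSupNorm M (y₂ - x))) with hE₂
  set E₁ := Real.exp (-(kappa163 (d + 1) / (d + 1) * torusSupNorm M (y₁ - x))) with hE₁
  set r : ℝ := zlen z / n with hr
  have hr0 : 0 ≤ r := div_nonneg (zlen_nonneg z) (Nat.cast_nonneg n)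
  have hα'0 : 0 ≤ (1 + α) / 2 := by linarith
  have hα'1 : (1 + α) / 2 < 1 := by linarith
  have hθ0 := thetaH_nonneg hα0
  have hθ1 := thetaH_le_one hα0 hα1.le
  have hT0 : 0 ≤ CHolderTorus (d + 1) ((1 + α) / 2) := CHolderTorus_nonneg μ hα'0 hα'1
  have hC0 : 0 ≤ CdecD d := CdecD_nonneg
  have hm0 : 0 ≤ max E₂ E₁ := le_max_of_le_left (Real.exp_pos _).le
  -- the Hölder bound at exponent (1+α)/2
  have hA : X ≤ CHolderTorus (d + 1) ((1 + α) / 2) * r ^ ((1 + α) / 2) := by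
    have h := norm_dker_transl_sub_le n M μ lam ν (bpt n M (toT M y₁) a₁) (toT M x) z hα'0 hα'1
    rw [← hz] at h
    exact h
  -- the decaying sup bound at both endpoints
  have hB : X ≤ 2 * CdecD d * max E₂ E₁ := by
    have h2 := norm_dker_bpt_le n M μ lam ν a₂ y₂ x
    have h1 := norm_dker_bpt_le n M μ lam ν a₁ y₁ x
    calc X ≤ ‖dker n M μ lam ν (bpt n M (toT M y₂) a₂) (toT M x)‖ +
          ‖dker n M μ lam ν (bpt n M (toT M y₁) a₁) (toT M x)‖ := norm_sub_le _ _
      _ ≤ CdecD d * E₂ + CdecD d * E₁ := by unfold CdecD; exact add_le_add h2 h1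
      _ ≤ CdecD d * max E₂ E₁ + CdecD d * max E₂ E₁ :=
          add_le_add (mul_le_mul_of_nonneg_left (le_max_left _ _) hC0)
            (mul_le_mul_of_nonneg_left (le_max_right _ _) hC0)
      _ = 2 * CdecD d * max E₂ E₁ := by ring
  -- interpolate
  calc X ≤ (CHolderTorus (d + 1) ((1 + α) / 2) * r ^ ((1 + α) / 2)) ^ thetaH α *
        (2 * CdecD d * max E₂ E₁) ^ (1 - thetaH α) := interp_le (norm_nonneg _) hA hB hθ0 hθ1
    _ = CHD d α * r ^ α * max E₂ E₁ ^ (1 - thetaH α) := by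
        rw [Real.mul_rpow hT0 (Real.rpow_nonneg hr0 _), Real.mul_rpow (by linarith) hm0,
          ← Real.rpow_mul hr0, half_one_add_mul_thetaH hα0]
        unfold CHD
        ring

/-- **DECAY FROM THE NEARER ENDPOINT BLOCK**: the same bound with `max(e^{−δd₂}, e^{−δd₁})^{1−θ(α)}` written as
`e^{−δ·((1−α)/(1+α))·min(d₂, d₁)}`, `d_i = |y_i − x|_{T,∞}`, `δ = κ₁₆₃(d+1)/(d+1)` — Hölder gain `(‖z‖₂/n)^α` AND
exponential decay at rate `δ(1−α)/(1+α)`, uniformly in `n`. [folklore] -/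
theorem norm_dker_sub_le_decay' (μ lam ν : Fin (d + 1)) (y₁ y₂ x : Fin (d + 1) → ℤ)
    (a₁ a₂ : Fin (d + 1) → Fin n) (z : Fin (d + 1) → ℤ)
    (hz : bpt n M (toT M y₂) a₂ = bpt n M (toT M y₁) a₁ + toT (fine n M) z) {α : ℝ} (hα0 : 0 ≤ α) (hα1 : α < 1) :
    ‖dker n M μ lam ν (bpt n M (toT M y₂) a₂) (toT M x) - dker n M μ lam ν (bpt n M (toT M y₁) a₁) (toT M x)‖
      ≤ CHD d α * (zlen z / n) ^ α *
          Real.exp (-(kappa163 (d + 1) / (d + 1) * ((1 - α) / (1 + α)) *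
            min (torusSupNorm M (y₂ - x)) (torusSupNorm M (y₁ - x)))) := by
  refine (norm_dker_sub_le_decay n M μ lam ν y₁ y₂ x a₁ a₂ z hz hα0 hα1).trans (le_of_eq ?_)
  congr 1
  rw [one_sub_thetaH hα0]
  have hδ : 0 ≤ kappa163 (d + 1) / (d + 1) := div_nonneg (kappa163_pos _).le (by positivity)
  have hmax : max (Real.exp (-(kappa163 (d + 1) / (d + 1) * torusSupNorm M (y₂ - x))))
        (Real.exp (-(kappa163 (d + 1) / (d + 1) * torusSupNorm M (y₁ - x))))
      = Real.exp (-(kappa163 (d + 1) / (d + 1) *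
          min (torusSupNorm M (y₂ - x)) (torusSupNorm M (y₁ - x)))) := by
    rcases le_total (torusSupNorm M (y₂ - x)) (torusSupNorm M (y₁ - x)) with hle | hle
    · rw [min_eq_left hle, max_eq_left]
      exact Real.exp_le_exp.mpr (neg_le_neg (mul_le_mul_of_nonneg_left hle hδ))
    · rw [min_eq_right hle, max_eq_right]
      exact Real.exp_le_exp.mpr (neg_le_neg (mul_le_mul_of_nonneg_left hle hδ))
  rw [hmax, ← Real.exp_mul]
  congr 1
  ring

/-- **THE DECAYING HÖLDER BOUND FOR THE TYPED OPERATOR** (exponentially weighted `ℓ¹` form): for every unit-lattice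
1-form `B`, fine points `x₁ = n·ȳ₁ + a₁`, `x₂ = n·ȳ₂ + a₂ = x₁ + z̄`, any family of lattice representatives
`r : T₁ → ℤ^{d+1}` (`toT ∘ r = id`) and `0 ≤ α < 1`,
`|∂_ν(H_kB)_μ(x₂) − ∂_ν(H_kB)_μ(x₁)| ≤ CHD(d,α)·(‖z‖₂/n)^α · Σ_{y,λ} max(e^{−δ|y₂−r(y)|_T}, e^{−δ|y₁−r(y)|_T})^{(1−α)/(1+α)} |B_λ(y)|`.
[cite: Balaban1984PropagatorsI, p.29 lines 1–2 «This implies bounds on (1/|x′−x|^α)|∂_ν(H_kB)_μ(x′) − ∂_ν(H_kB)_μ(x)| (see the proof of Lemma 2.4 in [2].)» (text of the claim only; typed form, proof and constants ours)] [folklore] -/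
theorem norm_fdiff_HkOp_mulVec_sub_le_decay (B : Tor M × Fin (d + 1) → ℂ) (μ ν : Fin (d + 1))
    (y₁ y₂ : Fin (d + 1) → ℤ) (a₁ a₂ : Fin (d + 1) → Fin n) (z : Fin (d + 1) → ℤ)
    (hz : bpt n M (toT M y₂) a₂ = bpt n M (toT M y₁) a₁ + toT (fine n M) z)
    (r : Tor M → (Fin (d + 1) → ℤ)) (hr : ∀ y, toT M (r y) = y) {α : ℝ} (hα0 : 0 ≤ α) (hα1 : α < 1) :
    ‖(fdiff (fine n M) (n : ℂ) ν *ᵥ (HkOp n M *ᵥ B)) (bpt n M (toT M y₂) a₂, μ)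
        - (fdiff (fine n M) (n : ℂ) ν *ᵥ (HkOp n M *ᵥ B)) (bpt n M (toT M y₁) a₁, μ)‖
      ≤ CHD d α * (zlen z / n) ^ α *
          ∑ y : Tor M, ∑ lam : Fin (d + 1),
            max (Real.exp (-(kappa163 (d + 1) / (d + 1) * torusSupNorm M (y₂ - r y))))
                (Real.exp (-(kappa163 (d + 1) / (d + 1) * torusSupNorm M (y₁ - r y)))) ^ (1 - thetaH α) *
              ‖B (y, lam)‖ := by
  rw [fdiff_HkOp_mulVec, fdiff_HkOp_mulVec, ← Finset.sum_sub_distrib]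
  simp_rw [← Finset.sum_sub_distrib, ← sub_mul]
  rw [Finset.mul_sum]
  refine (norm_sum_le _ _).trans (Finset.sum_le_sum fun y _ => ?_)
  rw [Finset.mul_sum]
  refine (norm_sum_le _ _).trans (Finset.sum_le_sum fun lam _ => ?_)
  rw [norm_mul, ← mul_assoc]
  refine mul_le_mul_of_nonneg_right ?_ (norm_nonneg _)
  have h := norm_dker_sub_le_decay n M μ lam ν y₁ y₂ (r y) a₁ a₂ z hz hα0 hα1
  rw [hr y] at h
  exact h

end Interpolation

end

end Literature.MathematicalPhysics.QuantumFieldTheory.Balaban1983to89.B5Hk163TorusHolderDecay
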